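import Summits.KontsevichZagierPeriods.KontsevichZagierPeriods.Theses.TorsionLogs
import Summits.KontsevichZagierPeriods.KontsevichZagierPeriods.Theorems.TorsionLogsNeronTorsionSector
import Literature.NumberTheory.Transcendental.KZKernelConjectureForms

/-!
# F4 ON-PATH LEMMA `KontsevichZagierPeriods → NeronTorsionThirdKind` (crux `TorsionSectorComplete`, stmt-KontsevichZagierPeriods-14212)
# — forward rung G1 (`next-rung`, gen 19) over the PROVED floor `NeronTorsionPrimitiveChain`
#   (seed g1-KontsevichZagierPeriods-17981, `Cruxes.NeronTorsionSector.Translation.stub_assembly`)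

RUNG `NeronTorsionThirdKind := ∀ eggPoles : Bool, ThirdKindMember eggPoles` — the ONE hypothesis of the floor that is
dropped is the KIND of the differential carried along the torsion arc: the floor carries the differential of the SECOND
kind `η = x dx/y` (pole of order two at `O`, no residues; hence its iterated/product representations `rI`, `rP` and the
QUADRATIC coefficients `q², p²` of `ρ = 1/2 − a/N = p/q` — the archimedean Néron pairing ON THE DIAGONAL, i.e. the local
height `λ(P)`), member `true` carries a differential of the THIRD kind with FREE simple poles
`R = (x_R, y_R)`, `R' = (x_R', y_R')` on the real EGG `e₃ < x < e₂` of the same curve: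
    `θ_{R,R'}(x) dx = (y_R/(x − x_R) − y_R'/(x − x_R')) dx/√f(x)`   (`= 2·ω^odd_{R,R'}`, the `y`-odd part of the normalised
third-kind form `ω_{R,R'} = ½[(y + y_R)/(x − x_R) − (y + y_R')/(x − x_R')] dx/y`, `Res_R = 1`, `Res_{R'} = −1`; the
`y`-even part `½ d log((x − x_R)/(x − x_R'))` is an exact algebraic logarithm) — the archimedean Néron / biextension
pairing OFF THE DIAGONAL `⟨(P) − (O), (R) − (R')⟩_∞`, LINEAR in the torsion class.  Same curve data, same torsion datum
`N·∫_{x_P}^∞ dx/√f = a·ω₁` VERBATIM, same two base intervals `(e₁, x_P)` (the arc `T₁ → P`) and `(e₁, ∞)` (the half real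
period) as the floor's `rI`, `rP`; the representations drop from dimension 2 to dimension 1 and the coefficients from
`(q², p²)` to `(N, N − 2a)`:

* member `false` = `Theses.TorsionLogs.NeronTorsionPrimitiveChain` VERBATIM (the floor; F3 witness
  `thirdKindMember_false` = `stub_assembly`, `Iff.rfl`).
* member `true`  = the TIED THIRD-KIND TORSION SECTOR (typed inline): for `y² = f(x) = 4x³ − g₂x − g₃` with three real
  roots `e₃ < e₂ < e₁` (algebraic `g₂, g₃`), `P = (x_P, ·)`, `x_P > e₁`, with the floor's torsion datum
  `N ∫_{x_P}^∞ dx/√f = a · 2∫_{e₁}^∞ dx/√f` (`3 ≤ N`, `0 < 2a < N`), algebraic egg points `R, R'`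
  (`e₃ < x_R, x_R' < e₂`, `y_R² = f(x_R)`, `y_R'² = f(x_R')`, any signs), the 1-dimensional representations
  `rA = [(e₁, x_P), θ_{R,R'}]`, `rL = [(e₁, ∞), θ_{R,R'}]` and a log carrier `rM = [(1, α), dt/t]`, every tied
  integer-cleared element `(jN)[rA] − (j(N − 2a))[rL] − m[rM]` of value `0` lies in `KZ.relations`.
  Its value content is the THIRD-KIND TORSION IDENTITY
      `N·∫_{e₁}^{x_P} θ_{R,R'} − (N − 2a)·∫_{e₁}^{∞} θ_{R,R'} = −2 log α_P(R,R')`,                          (♠)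
      `log α_P(R,R') = N·∫_{O}^{P} ω^odd_{R,R'} − a·∮_{E⁰(ℝ)} ω^odd_{R,R'} = ε_P · log |f_P(R')/f_P(R)| + (N/2) log|(x_P − x_R)/(x_P − x_R')|`,
  `div f_P = N(P) − N(O)`, `ε_P = sign y_P` — Abel's theorem with logarithmic poles / the reciprocity law for the normalised
  third-kind integral against the principal divisor `N(P) − N(O)`, closed up by `a` real loops (seat numerics, job
  j066664: 30 configurations `(N,a) ∈ {(4,1),(5,1),(5,2),(6,1),(7,2)}`, both sheets of `P`, three sign patterns of
  `(y_R, y_R')`, residual ≤ 1.3e−16; the identity-component version with `R, R'` beyond `P` returns the integer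
  `(2N·∫ω_{R,R'} − log|f(R)/f(R')|)/∮_egg = ±(N − 2a)` exactly).

Why ONE move and why UP: the floor is the diagonal value `⟨D_P, D_P⟩` of the archimedean height pairing at the torsion
divisor `D_P` (Néron function, `q²[∬ηω] + p²[η₁ω₁/2] = c[log B]`); the rung frees the SECOND ARGUMENT of the pairing to an
arbitrary algebraic degree-zero divisor `(R) − (R')` disjoint from the real component.  The summit implies it (on-path
lemma `neronTorsionThirdKind_of_kontsevichZagierPeriods`, sorry-free, via `kzKernelConjecture_iff_isRational`); the floor
does not (new free algebraic parameters `x_R, x_R'` and a differential with residues, absent from every floor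
representation).  No rung of gens 1–18 on this floor (shifted/two-point/duplication/addition/distribution/coset/Jensen/
oval/acnodal/height/complex points/argument/depth three/variation/isogeny/genus two/(3,4)/complex curve) has a third-kind
integrand: all of them keep `η`.  [cite: KontsevichZagier2001, §1.2 Conjecture 1] [cite: Lang1983, Ch. 13]
[cite: Silverman1994, VI.1–VI.4]
-/

noncomputable section

open Set MeasureTheory Filter Topology
open Literature.NumberTheory.Transcendental Literature.ModelTheory.ExponentialFields
open Summit.KontsevichZagierPeriods.KontsevichZagierPeriods.Theses.TorsionLogs (NeronTorsionPrimitiveChain TorsionSectorComplete)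
open Summit.KontsevichZagierPeriods.KontsevichZagierPeriods.Cruxes.NeronTorsionSector.Translation (stub_assembly)

-- `Summit.KontsevichZagierPeriods.KontsevichZagierPeriods.…` is the tree's mandated layout (single-conjunct summit).
set_option linter.dupNamespace false

namespace Summit.KontsevichZagierPeriods.KontsevichZagierPeriods.Cruxes.TorsionSectorComplete.NeronTorsionThirdKind

/-! ### The rung: a Bool-indexed family of tied Néron–torsion sectors (second kind ↦ third kind) -/

/-- The two members.  `false` ↦ the floor `NeronTorsionPrimitiveChain` VERBATIM (second-kind differential `η` along the
torsion arc: `q²[I(P)] + p²[η₁ω₁/2] − c[log B] ∈ KZ.relations`).  `true` ↦ the TIED THIRD-KIND TORSION SECTOR: same real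
curve in Weierstrass form with three real roots `e₃ < e₂ < e₁`, same torsion datum for `x_P > e₁`, free algebraic poles
`R, R'` on the egg, the third-kind density `θ_{R,R'}(t) = (y_R/(t − x_R) − y_R'/(t − x_R'))/√f(t)` on the floor's two base
intervals `(e₁, x_P)` and `(e₁, ∞)`, and every tied integer-cleared element `(jN)[rA] − (j(N−2a))[rL] − m[(1,α), dt/t]` of
value `0` claimed to lie in `KZ.relations` (identity (♠) of the module docstring).
[cite: KontsevichZagier2001, §1.2] [cite: Lang1983, Ch. 13] -/
def ThirdKindMember : Bool → Prop
  | false => ∀ (g₂ g₃ e₁ xP yP : ℝ) (N a p q : ℕ) (f : ℝ → ℝ), (∀ x, f x = 4 * x ^ 3 - g₂ * x - g₃) → g₂ ^ 3 - 27 * g₃ ^ 2 ≠ 0 → f e₁ = 0 → 0 < e₁ → (∀ x, e₁ < x → 0 < f x) → e₁ < xP → yP ^ 2 = f xP → 3 ≤ N → 0 < a → 2 * a < N → (∀ hns : (⟨0, 0, 0, -g₂ / 4, -g₃ / 4⟩ : WeierstrassCurve ℝ).toAffine.Nonsingular xP (yP / 2), addOrderOf (WeierstrassCurve.Affine.Point.some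 xP (yP / 2) hns) = N) → (N : ℝ) * (∫ x in Set.Ioi xP, (Real.sqrt (f x))⁻¹) = a * (2 * ∫ x in Set.Ioi e₁, (Real.sqrt (f x))⁻¹) → Nat.Coprime p q → (q : ℤ) * ((N : ℤ) - 2 * (a : ℤ)) = (p : ℤ) * (2 * (N : ℤ)) → ∀ (rI rP : Literature.NumberTheory.Transcendental.KZ.IntegralRep 2), rI.domain = {z | e₁ < z 1 ∧ z 1 < z 0 ∧ z 0 < xP} → Set.EqOn rI.integrand (fun z => z 1 / (Real.sqrt (f (z 1)) * Real.sqrt (f (z 0)))) rI.domain → rP.domain = {z | e₁ < z 0 ∧ e₁ < z 1} → Set.EqOn rP.integrand (fun z => (Real.sqrt (f (z 0)))⁻¹ * ((g₂ * z 1 + 2 * g₃) / (2 * (z 1) ^ 2 * Real.sqrt (f (z 1))))) rP.domain → ∃ (c : ℤ) (B : ℝ) (rB : Literature.NumberTheory.Transcendental.KZ.IntegralRep 1), 1 < B ∧ IsAlgebraic ℚ B ∧ rB.domain = {t | 1 < t 0 ∧ t 0 < B} ∧ Set.EqOn rB.integrand (fun t => (t 0)⁻¹) rB.domain ∧ ((q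 : ℤ) ^ 2) • Literature.NumberTheory.Transcendental.KZ.of rI + ((p : ℤ) ^ 2) • Literature.NumberTheory.Transcendental.KZ.of rP - c • Literature.NumberTheory.Transcendental.KZ.of rB ∈ Literature.NumberTheory.Transcendental.KZ.relations
  | true => ∀ (g₂ g₃ e₁ e₂ e₃ xP xR yR xR' yR' α : ℝ) (N a : ℕ) (j m : ℤ) (f : ℝ → ℝ), IsAlgebraic ℚ g₂ → IsAlgebraic ℚ g₃ → IsAlgebraic ℚ xR → IsAlgebraic ℚ xR' → (∀ x, f x = 4 * x ^ 3 - g₂ * x - g₃) → f e₁ = 0 → f e₂ = 0 → f e₃ = 0 → e₃ < e₂ → e₂ < e₁ → e₃ < xR → xR < e₂ → yR ^ 2 = f xR → e₃ < xR' → xR' < e₂ → yR' ^ 2 = f xR' → e₁ < xP → 3 ≤ N → 0 < a → 2 * a < N → (N : ℝ) * (∫ x in Set.Ioi xP, (Real.sqrt (f x))⁻¹) = a * (2 * ∫ x in Set.Ioi e₁, (Real.sqrt (f x))⁻¹) → 1 < α → ∀ (rA rL rM : Literature.NumberTheory.Transcendental.KZ.IntegralRep 1), rA.domain = {t | e₁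 < t 0 ∧ t 0 < xP} → Set.EqOn rA.integrand (fun t => (yR / (t 0 - xR) - yR' / (t 0 - xR')) / Real.sqrt (f (t 0))) rA.domain → rL.domain = {t | e₁ < t 0} → Set.EqOn rL.integrand (fun t => (yR / (t 0 - xR) - yR' / (t 0 - xR')) / Real.sqrt (f (t 0))) rL.domain → rM.domain = {t | 1 < t 0 ∧ t 0 < α} → Set.EqOn rM.integrand (fun t => (t 0)⁻¹) rM.domain → (j : ℝ) * ((N : ℝ) * rA.value - ((N : ℝ) - 2 * (a : ℝ)) * rL.value) = m * rM.value → (j * (N : ℤ)) • Literature.NumberTheory.Transcendental.KZ.of rA - (j * ((N : ℤ) - 2 * (a : ℤ))) • Literature.NumberTheory.Transcendental.KZ.of rL - m • Literature.NumberTheory.Transcendental.KZ.of rM ∈ Literature.NumberTheory.Transcendental.KZ.relations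

/-- **THE RUNG.** Both members: the floor (second kind, diagonal Néron pairing) and the third-kind torsion sector
(off-diagonal pairing against a free egg divisor). -/
def NeronTorsionThirdKind : Prop := ∀ eggPoles : Bool, ThirdKindMember eggPoles

/-! ### Sorry-free infrastructure: floor member, on-path lemma -/

/-- Member `false` of the family is the floor `NeronTorsionPrimitiveChain` on the nose. -/
theorem thirdKindMember_false_iff :
    ThirdKindMember false ↔
      Summit.KontsevichZagierPeriods.KontsevichZagierPeriods.Theses.TorsionLogs.NeronTorsionPrimitiveChain :=
  Iff.rfl

/-- **F3 WITNESS — the floor is member `false` of the family** (names the seed `stub_assembly`). -/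
theorem thirdKindMember_false : ThirdKindMember false :=
  thirdKindMember_false_iff.mpr stub_assembly

/-- F3 in the brief's literal shape `example : Rung <floor index> := by simpa [Rung] using <seed>`. -/
example : ThirdKindMember false :=
  (stub_assembly : Summit.KontsevichZagierPeriods.KontsevichZagierPeriods.Theses.TorsionLogs.NeronTorsionPrimitiveChain)

/-- The rung restricted to the new index is all that is open. -/
theorem neronTorsionThirdKind_iff_true : NeronTorsionThirdKind ↔ ThirdKindMember true :=
  ⟨fun h => h true, fun h b => by cases b <;> [exact thirdKindMember_false; exact h]⟩

/-- **F4 ON-PATH LEMMA — the summit implies the rung** (member `false` is a theorem outright; member `true` by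
Conjecture 1 in kernel form, `kzKernelConjecture_iff_isRational`: a tied element evaluates to `0` by its value
hypothesis).  Tagged `@[simp]` for the tribunal's forward probe. [cite: KontsevichZagier2001, §1.2] -/
@[simp] theorem neronTorsionThirdKind_of_kontsevichZagierPeriods (h : _root_.KontsevichZagierPeriods) :
    NeronTorsionThirdKind := by
  have hK : KZKernelConjecture := kzKernelConjecture_iff_isRational.mpr h
  intro b
  cases b
  · exact thirdKindMember_false
  · intro g₂ g₃ e₁ e₂ e₃ xP xR yR xR' yR' α N a j m f _ _ _ _ _ _ _ _ _ _ _ _ _ _ _ _ _ _ _ _ _ _ rA rL rM _ _ _ _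
      _ _ hval
    apply hK
    rw [map_sub, map_sub, map_zsmul, map_zsmul, map_zsmul, KZ.eval_of, KZ.eval_of, KZ.eval_of, zsmul_eq_mul,
      zsmul_eq_mul, zsmul_eq_mul]
    push_cast
    linear_combination hval

/-- The same as an implication `S → Rung`. -/
theorem onPath : _root_.KontsevichZagierPeriods → NeronTorsionThirdKind :=
  neronTorsionThirdKind_of_kontsevichZagierPeriods

end Summit.KontsevichZagierPeriods.KontsevichZagierPeriods.Cruxes.TorsionSectorComplete.NeronTorsionThirdKind

end
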